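import Summits.QuantumAdvantage.QuantumAdvantage.Theses.PadKuperberg
import Literature.Computability.Cryptography.CsidhTorsorFamilyAxioms

/-!
# `TorsorHard` (stmt-QuantumAdvantage-0927): the typed decompositions examined by the crux-strategist

Crux-strategist workfile (route `PadKuperberg`, deciding crux `TorsorHard` = thesis X, binned
RESTATED by the route re-audit: no crux of the route is strictly weaker than the summit).
Companion of `STRATEGY-CENSUS.md` in the same directory: every signature quoted there elaborates
here, and every assembly quoted there is proved here (sorry-free).

Contents.

* §1 `Axioms13`, `PolyTime6`, `SubexpHard`: the three conjuncts of the white-box torsor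
  interface as predicates of a family `(lab, elt, one, mul, act, gens)`, and
  `torsorHard_iff : TorsorHard ↔ ∃ d F, Axioms13 F ∧ PolyTime6 d F ∧ SubexpHard F` (`Iff.rfl`).
* §2 **D-CSIDH**, the best typed decomposition found: over the LANDED bit-level CSIDH family
  `Literature.Computability.Cryptography.Csidh.csidhLab/…/csidhGens` (definition item
  `defn-csidhTorsorFamily`, `CsidhTorsorFamily.lean` + `CsidhTorsorFamilyAxioms.lean`):
  `CsidhStructure` (13 axioms, eventually in the threshold) ∧ `CsidhEval` (the six TM2-level
  `PolyTimeComputable` clauses at some padding exponent `d`) ∧ `CsidhVectorizationHard`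
  (classical `L_p(1/2, c)`-hardness of CSIDH vectorization for every `c`) ⟹ `TorsorHard`
  (`TorsorHard_of_csidh`, a trivial seam: anonymous constructor at the max of three thresholds),
  together with the conditional discharge of the structure piece from the tree's named facts
  `csidhStructure_of_facts : csidh_classGroupAction → jmv_smallPrimesGenerate → ERH → CsidhStructure`
  (ten lines over `Csidh.torsorAxioms`).
* §3 **D-EC**, the GRH-free leaf: `EcdlpSubexpHard` (worst-case prime-field ECDLP in a prime-order
  subgroup of order `n` with `n² > q + 1 + 2√q`, classically `L(1/2, c)`-hard for every `c`), typed
  over Mathlib's `WeierstrassCurve.Affine.Point (ZMod q)`; the bridge `EcdlpSubexpHard → TorsorHard`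
  is the EC-DLOG torsor instantiation (paper-level, XL; not in the tree) and is NOT proved here —
  the census records why this leaf violates clause (c) in substance (EC-Shor).
* §4 **D-W**, world / bridge splits: `TorsorHard_of_worlds`, `TorsorHard_of_bridge`,
  `torsorHard_iff_ecBridge_and_residual` — one-line seams, typed so that the census rows are
  statements and not prose.
* §5 two kernel-checked structural facts: `notSummitWorld_iff_summit` (modulo the route's two
  support items the piece `¬S → X` IS the summit — the typed meaning of RESTATED) and
  `padLang_not_mem_BPP` (`X ∧ PadDown` alone, without Kuperberg, puts the explicit padded
  vectorization-bit language `L_pad(d)` outside `BPP`; on paper `L_pad(d) ∈ UP ∩ coUP`, so the crux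
  is of separation strength `NP ⊄ BPP` jointly with a provable item — census W1).

Nothing here is registered as a LINE (no `stub_*`): the census explains why (clause (d) — the
hardness leaf of every decomposition is a super-polynomial classical lower bound for an explicit
problem, hypothesis-type, with no plan on this hub or in print). planner-cstrat-stmt-QuantumAdvantage-0927-r1-0, 2026-08-17.
-/

set_option linter.dupNamespace false
set_option linter.unusedVariables false

noncomputable section

namespace Summit.QuantumAdvantage.QuantumAdvantage.Cruxes.TorsorHard.Split

open Summit.QuantumAdvantage.QuantumAdvantage.Theses.PadKuperberg
open Literature.Computability.Complexity
open Literature.Computability.Cryptography.Csidh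
open Literature.NumberTheory.QuadraticFields.Quadratic
open Literature.NumberTheory.QuadraticFields.Quadratic.BinQF
open _root_.Computability

attribute [local instance] isDomain_zsqrtd_neg

/-! ## §1 The white-box torsor interface, factored into its three conjuncts -/

/-- The thirteen torsor axioms of the interface (clauses 1–13 of `TorsorHard`, verbatim), as a
predicate of the family. [folklore] -/
def Axioms13 (lab elt : List Bool → List Bool → Bool) (one : List Bool → List Bool)
    (mul act : List Bool → List Bool → List Bool → List Bool)
    (gens : List Bool → List (List Bool)) : Prop :=
  (∀ p g h, lab p g = true → lab p h = true → lab p (mul p g h) = true) ∧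
  (∀ p, lab p (one p) = true) ∧
  (∀ p g, lab p g = true → mul p (one p) g = g) ∧
  (∀ p g h k, lab p g = true → lab p h = true → lab p k = true →
    mul p (mul p g h) k = mul p g (mul p h k)) ∧
  (∀ p g h, lab p g = true → lab p h = true → mul p g h = mul p h g) ∧
  (∀ p g, lab p g = true → ∃ h, lab p h = true ∧ mul p g h = one p) ∧
  (∀ p g z, lab p g = true → elt p z = true → elt p (act p g z) = true) ∧
  (∀ p z, elt p z = true → act p (one p) z = z) ∧
  (∀ p g h z, lab p g = true → lab p h = true → elt p z = true →
    act p (mul p g h) z = act p g (act p h z)) ∧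
  (∀ p z₀ z₁, elt p z₀ = true → elt p z₁ = true → ∃! g, lab p g = true ∧ act p g z₀ = z₁) ∧
  (∀ p g, lab p g = true → g.length ≤ p.length) ∧
  (∀ p, ∀ h ∈ gens p, lab p h = true) ∧
  (∀ p g, lab p g = true → ∃ es : List ℕ,
    g = (List.zipWith (fun h e => (mul p h)^[e] (one p)) (gens p) es).foldr (mul p) (one p))

/-- The six TM2-level `PolyTimeComputable` clauses of the interface at padding exponent `d`
(clauses 14–19 of `TorsorHard`, verbatim): `lab`, `elt`, `one`, `gens`, `mul` polynomial-time,
`act` polynomial-time in the `m_d`-padded input, `m_d(l) = 2^(d·isqrt(l·log₂ l)+d)`, `l = |prm|`.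
[folklore] -/
def PolyTime6 (d : ℕ) (lab elt : List Bool → List Bool → Bool) (one : List Bool → List Bool)
    (mul act : List Bool → List Bool → List Bool → List Bool)
    (gens : List Bool → List (List Bool)) : Prop :=
  Literature.Computability.Complexity.PolyTimeComputable
      (fun q : List Bool × List Bool => Literature.Computability.Complexity.boolPair q.1 q.2)
      Computability.encodeBool (fun q : List Bool × List Bool => lab q.1 q.2) ∧
  Literature.Computability.Complexity.PolyTimeComputable
      (fun q : List Bool × List Bool => Literature.Computability.Complexity.boolPair q.1 q.2)
      Computability.encodeBool (fun q : List Bool × List Bool => elt q.1 q.2) ∧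
  Literature.Computability.Complexity.PolyTimeComputable (id : List Bool → List Bool)
      (id : List Bool → List Bool) one ∧
  Literature.Computability.Complexity.PolyTimeComputable (id : List Bool → List Bool)
      (Computability.encodingList Bool).listBool.encode gens ∧
  Literature.Computability.Complexity.PolyTimeComputable
      (fun t : List Bool × List Bool × List Bool =>
        Literature.Computability.Complexity.boolPair t.1
          (Literature.Computability.Complexity.boolPair t.2.1 t.2.2))
      (id : List Bool → List Bool) (fun t : List Bool × List Bool × List Bool => mul t.1 t.2.1 t.2.2) ∧
  Literature.Computability.Complexity.PolyTimeComputable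
      (fun t : List Bool × List Bool × List Bool =>
        Literature.Computability.Complexity.boolPair
          (Literature.Computability.Complexity.boolPair t.1
            (Literature.Computability.Complexity.boolPair t.2.1 t.2.2))
          (List.replicate (2 ^ (d * Nat.sqrt (t.1.length * Nat.log 2 t.1.length) + d)) true))
      (id : List Bool → List Bool) (fun t : List Bool × List Bool × List Bool => act t.1 t.2.1 t.2.2)

/-- The hardness conjunct of the interface (clause 20 of `TorsorHard`, verbatim): for every `c'`
no randomized classical algorithm vectorizes the family in time
`2^(c'·isqrt(l·log₂ l)+c')·(|⟨prm,z₀,z₁⟩|+1)^c'` with success `≥ 2/3` on every valid instance —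
i.e. classical hardness beyond `L(1/2, c)` for every `c` when `|prm| = Θ(log |G|)`. [folklore] -/
def SubexpHard (lab elt : List Bool → List Bool → Bool)
    (act : List Bool → List Bool → List Bool → List Bool) : Prop :=
  ∀ c' : ℕ, ¬ ∃ A : Literature.Computability.Complexity.RandAlg (List Bool × List Bool × List Bool) (List Bool),
    A.RunsInTime
      (fun t : List Bool × List Bool × List Bool =>
        Literature.Computability.Complexity.boolPair t.1
          (Literature.Computability.Complexity.boolPair t.2.1 t.2.2))
      (id : List Bool → List Bool)
      (fun t : List Bool × List Bool × List Bool =>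
        2 ^ (c' * Nat.sqrt (t.1.length * Nat.log 2 t.1.length) + c') *
          ((Literature.Computability.Complexity.boolPair t.1
            (Literature.Computability.Complexity.boolPair t.2.1 t.2.2)).length + 1) ^ c') ∧
    ∀ p z₀ z₁, elt p z₀ = true → elt p z₁ = true →
      (2 : ℝ) / 3 ≤ A.pr
        (fun t : List Bool × List Bool × List Bool =>
          Literature.Computability.Complexity.boolPair t.1
            (Literature.Computability.Complexity.boolPair t.2.1 t.2.2))
        (p, z₀, z₁) {g | lab p g = true ∧ act p g z₀ = z₁}

/-- **Normal form of the crux**: `TorsorHard` is literally "some family satisfies the thirteen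
axioms, the six poly-time clauses at some `d`, and the hardness conjunct" (definitional).
[folklore] -/
theorem torsorHard_iff :
    TorsorHard ↔ ∃ (d : ℕ) (lab elt : List Bool → List Bool → Bool) (one : List Bool → List Bool)
      (mul act : List Bool → List Bool → List Bool → List Bool) (gens : List Bool → List (List Bool)),
      Axioms13 lab elt one mul act gens ∧ PolyTime6 d lab elt one mul act gens ∧ SubexpHard lab elt act :=
  Iff.rfl

/-- The interface cannot be split into "existence" and "hardness" items without NAMING the family:
the two conjuncts share the existential witness. Formally, the product of the projections is
strictly weaker — `(∃ F, A F) ∧ (∃ F, H F)` does not give `∃ F, A F ∧ H F` — so every decomposition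
below pins the family (§2, §3) or cuts propositionally (§4). This lemma is the trivial direction,
recorded only to fix the shape. [folklore] -/
theorem exists_and_of_torsorHard (h : TorsorHard) :
    (∃ (d : ℕ) (lab elt : List Bool → List Bool → Bool) (one : List Bool → List Bool)
      (mul act : List Bool → List Bool → List Bool → List Bool) (gens : List Bool → List (List Bool)),
      Axioms13 lab elt one mul act gens ∧ PolyTime6 d lab elt one mul act gens) ∧
    (∃ (lab elt : List Bool → List Bool → Bool) (act : List Bool → List Bool → List Bool → List Bool),
      SubexpHard lab elt act) := by
  obtain ⟨d, lab, elt, one, mul, act, gens, hA, hP, hH⟩ := torsorHard_iff.1 h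
  exact ⟨⟨d, lab, elt, one, mul, act, gens, hA, hP⟩, ⟨lab, elt, act, hH⟩⟩

/-! ## §2 D-CSIDH: the decomposition over the landed CSIDH torsor family

The family at threshold `P₁` is `(csidhLab P₁, csidhElt P₁, csidhOne P₁, csidhMul P₁, csidhAct P₁,
csidhGens P₁)` (`Csidh.csidhTorsorFamily P₁`): on the parameter string of a prime `p ≡ 3 (mod 8)`,
`p ≥ max 5 P₁`, the class group `cl(ℤ[√-p])` labelled by reduced forms acting on the valid
Montgomery coefficients; the trivial one-point torsor on every other string. All three pieces are
stated "eventually in the threshold" (`∃ P₀, ∀ P₁ ≥ P₀`), so that the assembly can take the max. -/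

/-- **Piece 1 (structure).** Eventually in the threshold, the CSIDH family satisfies the thirteen
torsor axioms for every parameter string. Status: CONDITIONALLY PROVED in the tree —
`csidhStructure_of_facts` below from CSIDH Thm. 7 (`csidh_classGroupAction`, itself reduced in the
tree to Tate's isogeny theorem / finiteness of isomorphism classes of abelian varieties over `𝔽_p`,
`csidh_classGroupAction_of_finite_isoClasses`), Jao–Miller–Venkatesan generation
(`jmv_smallPrimesGenerate`) and `ExtendedRiemannHypothesis` (load-bearing for clause 13 with a
polynomial-size generator list: unconditionally only `O(√p)` generators are known to suffice).
[cite: CastryckEtAl2018, §3 Thm. 7] [cite: JaoMillerVenkatesan2009, Cor. 1.3] -/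
def CsidhStructure : Prop :=
  ∃ P₀ : ℕ, ∀ P₁ : ℕ, P₀ ≤ P₁ →
    Axioms13 (csidhLab P₁) (csidhElt P₁) (csidhOne P₁) (csidhMul P₁) (csidhAct P₁) (csidhGens P₁)

/-- **Piece 2 (effective evaluation).** For some padding exponent `d`, eventually in the threshold,
the six TM2-level `PolyTimeComputable` clauses hold for the CSIDH family: `csidhLab` (reduced-form
test), `csidhElt` (primality of `p` by AKS + supersingularity `#E_A(𝔽_p) = p + 1` by Schoof —
deterministic polynomial time), `csidhOne`, `csidhGens` (least square roots of `-p` modulo the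
`O(log³ p)` small primes, reduction), `csidhMul` (Gauss composition + reduction) are deterministic
polynomial time in print; the load-bearing clause is `csidhAct`: ONE DETERMINISTIC machine
evaluating the action of EVERY reduced form (an arbitrary ideal class, norm up to `≈ √p`) within
time polynomial in `2^(d·isqrt(l log₂ l)) = L_p(1/2, c_d)` (`l = |param p| = 14|p|₂ + 2`). In print
the evaluation of an arbitrary class is RANDOMIZED: `L_p(1/2)` ideal smoothing under GRH
(Childs–Jao–Soukharev 2014 §4), or (heuristic / GRH, still randomized) polynomial time through
higher-dimensional isogenies (Clapoti(s), Page–Robert 2023; KLaPoTi, Panny–Petit–Stopar 2025,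
doi:10.62056/ahp2wakrz, Remark 5: "all heuristics involved come from KLPT … can be removed following
Wesolowski [Wes21]"; PEGASIS 2025, doi:10.1007/978-3-032-01855-7_3). A deterministic `L(1/2)`
evaluation is NOT in print (it would in particular derandomize `L(1/2)` relation finding in
`cl(ℤ[√-p])`; deterministic class-group computation is exponential, Shanks `|D|^{1/4}`). Status:
OPEN (derandomization), XL to formalize even granted. [cite: ChildsJaoSoukharev2014, §4] -/
def CsidhEval : Prop :=
  ∃ d P₀ : ℕ, ∀ P₁ : ℕ, P₀ ≤ P₁ →
    PolyTime6 d (csidhLab P₁) (csidhElt P₁) (csidhOne P₁) (csidhMul P₁) (csidhAct P₁) (csidhGens P₁)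

/-- **Piece 3 (the leaf: classical hardness of CSIDH vectorization beyond `L(1/2)`).** Eventually in
the threshold, for every `c'` no randomized classical algorithm, given `param p` and two valid
coefficients `A₀, A₁`, outputs the code of the reduced form `f` with `[f] ⋆ E_{A₀} = E_{A₁}` within
time `2^(c'·isqrt(l log₂ l)+c')·poly` with probability `≥ 2/3` on every valid instance (GAIP /
vectorization for CSIDH; classical record `Õ(p^{1/4})` meet-in-the-middle, Delfs–Galbraith 2016;
generic-action lower bound `Ω(√N)`, Montgomery–Zhandry 2022; quantum `L_p(1/2)` under GRH,
Childs–Jao–Soukharev 2014). HYPOTHESIS-TYPE: a super-polynomial lower bound against all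
bounded-error classical algorithms for an explicit search problem with efficiently (randomized,
GRH) verifiable solutions — nothing in print proves any such bound; it is the post-quantum
assumption the route is a bridge on. [cite: CastryckEtAl2018, §7] [cite: DelfsGalbraith2016, Thm. 1] -/
def CsidhVectorizationHard : Prop :=
  ∃ P₀ : ℕ, ∀ P₁ : ℕ, P₀ ≤ P₁ → SubexpHard (csidhLab P₁) (csidhElt P₁) (csidhAct P₁)

/-- **Assembly of D-CSIDH** (clause (b); a TRIVIAL SEAM — the anonymous constructor at the max of
the three thresholds): structure ∧ effective evaluation ∧ hardness of the CSIDH family ⟹ the crux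
`TorsorHard` by name. [folklore] -/
theorem TorsorHard_of_csidh (h₁ : CsidhStructure) (h₂ : CsidhEval) (h₃ : CsidhVectorizationHard) :
    TorsorHard := by
  obtain ⟨P₁, hP₁⟩ := h₁
  obtain ⟨d, P₂, hP₂⟩ := h₂
  obtain ⟨P₃, hP₃⟩ := h₃
  exact torsorHard_iff.2
    ⟨d, csidhLab (max P₁ (max P₂ P₃)), csidhElt (max P₁ (max P₂ P₃)), csidhOne (max P₁ (max P₂ P₃)),
      csidhMul (max P₁ (max P₂ P₃)), csidhAct (max P₁ (max P₂ P₃)), csidhGens (max P₁ (max P₂ P₃)),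
      hP₁ _ (le_max_left _ _),
      hP₂ _ (le_trans (le_max_left _ _) (le_max_right _ _)),
      hP₃ _ (le_trans (le_max_right _ _) (le_max_right _ _))⟩

/-- **Piece 1 from explicit hypotheses** (the shape of the tree's `Csidh.torsorAxioms`): freeness and
transitivity of the action at the primes `p ≡ 3 (mod 8)`, `p ≥ max 5 P₀` (clause (3) of CSIDH
Thm. 7) and generation of `cl(ℤ[√-p])` by the classes of `Csidh.gens p` for those primes give the
thirteen axioms at EVERY threshold `P₁ ≥ P₀`. [cite: CastryckEtAl2018, §3 Thm. 7] -/
theorem axioms13_csidh_of_hyp (P₀ : ℕ)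
    (hfree : ∀ (p : ℕ) [Fact p.Prime], p % 8 = 3 → 5 ≤ p → P₀ ≤ p →
      ∀ A₀ A₁ : ZMod p, IsCoeff p A₀ → IsCoeff p A₁ →
        ∃! f : BinQF, IsLabel (-(p : ℤ)) f ∧ act p f A₀ = A₁)
    (hgen : ∀ (p : ℕ) [Fact p.Prime], p % 8 = 3 → 5 ≤ p → P₀ ≤ p →
      Subgroup.closure ((toClass (-(p : ℤ))) '' {f | f ∈ gens p}) = ⊤) :
    ∀ P₁ : ℕ, P₀ ≤ P₁ →
      Axioms13 (csidhLab P₁) (csidhElt P₁) (csidhOne P₁) (csidhMul P₁) (csidhAct P₁) (csidhGens P₁) :=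
  fun P₁ hP₁ => torsorAxioms P₁ (fun p _ h8 h5 hP => hfree p h8 h5 (le_trans hP₁ hP))
    (fun p _ h8 h5 hP => hgen p h8 h5 (le_trans hP₁ hP))

/-- **Piece 1 from the tree's named facts**: CSIDH Thm. 7 (`csidh_classGroupAction`), JMV Cor. 1.3
(`jmv_smallPrimesGenerate`) and ERH (`ExtendedRiemannHypothesis`) give `CsidhStructure` (the proof
of `Csidh.exists_torsorAxioms`, run at every larger threshold). ERH is load-bearing exactly for
clause 13 (generation by the `O(log³ p)` listed prime forms). [cite: JaoMillerVenkatesan2009, Cor. 1.3] -/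
theorem csidhStructure_of_facts (hcsidh : csidh_classGroupAction) (hjmv : jmv_smallPrimesGenerate)
    (hERH : Literature.NumberTheory.LFunctions.ExtendedRiemannHypothesis) : CsidhStructure := by
  obtain ⟨P₀, hP₀⟩ := exists_closure_toClass_gens_eq_top hjmv hERH
  exact ⟨P₀, axioms13_csidh_of_hyp P₀ (fun p _ h8 h5 _ => (hcsidh p h8 h5).2.2)
    (fun p _ h8 _ hP => hP₀ p hP (by omega))⟩

/-! ## §3 D-EC: the GRH-free leaf (worst-case prime-field ECDLP beyond `L(1/2)`)

The EC-DLOG torsor of the route review (gen-0/gen-2): `(ℤ/n, +)` acting by `a ⋆ Z = Z + a·P` on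
`⟨P⟩ = E(𝔽_q)[n]`, `n` prime with `n² > q + 1 + 2√q` (so the `𝔽_q`-rational `n`-torsion is
exactly `⟨P⟩` and the action is free and transitive), labels `a < n` in binary, `gens = [1]`,
`d = 0`; every interface clause holds UNCONDITIONALLY and DETERMINISTICALLY (AKS, on-curve and
`n·Q = O` checks, double-and-add), and vectorization of `(Z₀, Z₁)` is the discrete logarithm of
`Z₁ - Z₀` to the base `P`. The bridge `EcdlpSubexpHard → TorsorHard` is this instantiation
(paper-level; XL in the TM2 model; no EC torsor family exists in the tree, so it is not typed
here). The leaf itself is typed over Mathlib's affine points. -/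

/-- The code of an ECDLP instance: `⟨q, ⟨n, ⟨c₁, ⟨c₂, …⟩⟩⟩⟩` with the `cᵢ` the binary codes of the
five Weierstrass coefficients and the four affine coordinates (representatives in `{0,…,q-1}`).
[cite: AroraBarak2009, §0.1] -/
def ecCode (q n : ℕ) (cs : List ℕ) : List Bool :=
  Literature.Computability.Complexity.boolPair (encodeNat q)
    (Literature.Computability.Complexity.boolPair (encodeNat n)
      (cs.foldr (fun c acc => Literature.Computability.Complexity.boolPair (encodeNat c) acc) []))

/-- **The ECDLP leaf** (hypothesis-type). For every `c'`, no randomized classical algorithm running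
in time `2^(c'·isqrt(|x| log₂ |x|)+c')·(|x|+1)^c'` outputs, with probability `≥ 2/3` on every valid
instance, the discrete logarithm `k mod n` of `Q = k·P`, where `P` is an affine point of prime
order `n` on a Weierstrass curve over the prime field `𝔽_q` and `n² > q + 1 + 2√q`. Records in
print: no classical algorithm better than `Õ(√n)` (generic) is known for prime-field curves
outside the anomalous / low-embedding-degree families (Galbraith–Gaudry 2016 survey); Shor's
algorithm solves it in quantum polynomial time (Shor 1997 §6 adapted; Proos–Zalka 2003), which is
why this leaf gives the summit ON ITS OWN (census §3, clause (c)). [cite: GalbraithGaudry2016, §1]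
[cite: Shor1997, §6] -/
def EcdlpSubexpHard : Prop :=
  ∀ c' : ℕ, ¬ ∃ A : Literature.Computability.Complexity.RandAlg (List Bool) (List Bool),
    A.RunsInTime (id : List Bool → List Bool) (id : List Bool → List Bool)
      (fun x : List Bool => 2 ^ (c' * Nat.sqrt (x.length * Nat.log 2 x.length) + c') * (x.length + 1) ^ c') ∧
    ∀ (q : ℕ) [Fact q.Prime] (W : WeierstrassCurve.Affine (ZMod q)) (x₀ y₀ x₁ y₁ : ZMod q)
      (h₀ : W.Nonsingular x₀ y₀) (h₁ : W.Nonsingular x₁ y₁) (n k : ℕ),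
      n.Prime → q + 1 + 2 * Nat.sqrt q < n * n →
      addOrderOf (WeierstrassCurve.Affine.Point.some x₀ y₀ h₀) = n →
      WeierstrassCurve.Affine.Point.some x₁ y₁ h₁ = k • WeierstrassCurve.Affine.Point.some x₀ y₀ h₀ →
      (2 : ℝ) / 3 ≤ A.pr (id : List Bool → List Bool)
        (ecCode q n [W.a₁.val, W.a₂.val, W.a₃.val, W.a₄.val, W.a₆.val, x₀.val, y₀.val, x₁.val, y₁.val])
        {g | decodeNat g = k % n}

/-! ## §4 D-W: world and bridge splits (propositional cuts; one-line seams) -/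

/-- **Bridge split** `T ∧ (T → X) ⟹ X` (modus ponens; the Wiles shape). With `T := EcdlpSubexpHard`
this is D-EC, with `T := CsidhVectorizationHard ∧ ERH ∧ (derandomized evaluation)` it is D-CSIDH
re-associated. [folklore] -/
theorem TorsorHard_of_bridge {T : Prop} (hT : T) (hbridge : T → TorsorHard) : TorsorHard :=
  hbridge hT

/-- **World split** at any cut `C`: `(C → X) ∧ (¬C → X) ⟹ X` (excluded middle). [folklore] -/
theorem TorsorHard_of_worlds (C : Prop) (hC : C → TorsorHard) (hnC : ¬ C → TorsorHard) :
    TorsorHard :=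
  (Classical.em C).elim hC hnC

/-- The EC-world bridge: "if prime-field ECDLP is classically `L(1/2,c)`-hard for every `c`, some
white-box torsor family is" — the EC-DLOG torsor instantiation, a THEOREM in print (paper-level,
XL in the TM2 model). [cite: GalbraithGaudry2016, §1] -/
def EcWorldBridge : Prop := EcdlpSubexpHard → TorsorHard

/-- The post-quantum residual: "even if prime-field ECDLP falls to a classical `L(1/2)` algorithm,
some white-box torsor family (e.g. CSIDH) stays hard" — the route's distinctive content,
hypothesis-type. [cite: CastryckEtAl2018, §7] -/
def PostQuantumResidual : Prop := ¬ EcdlpSubexpHard → TorsorHard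

/-- `X ↔ EcWorldBridge ∧ PostQuantumResidual` (the world split at `C := EcdlpSubexpHard`, both
directions trivial). [folklore] -/
theorem torsorHard_iff_ecBridge_and_residual : TorsorHard ↔ EcWorldBridge ∧ PostQuantumResidual :=
  ⟨fun h => ⟨fun _ => h, fun _ => h⟩, fun h => TorsorHard_of_worlds EcdlpSubexpHard h.1 h.2⟩

/-! ## §5 Two kernel-checked structural facts used by the census -/

/-- **The typed meaning of RESTATED.** Modulo the route's two support items (`KuperbergPad`,
`PadDown`, both theorem-type) the world split of `X` at the cut `C := S` degenerates: the piece
"`X` holds in the world `¬S`" is EQUIVALENT to the summit itself (because `closes` gives `X → S`),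
so `X ⇐ (S → X) ∧ (¬S → X)` has a summit-equivalent piece (clause (c)) and a converse piece
`S → X` ("some BQP∖BPP language ⇒ a hard white-box torsor") that nobody conjectures. [folklore] -/
theorem notSummitWorld_iff_summit (h₁ : KuperbergPad) (h₂ : PadDown) :
    (¬ _root_.QuantumAdvantage → TorsorHard) ↔ _root_.QuantumAdvantage :=
  ⟨fun h => Classical.byContradiction fun hn => hn (closes h₁ h₂ (h hn)),
    fun hs hn => (hn hs).elim⟩

/-- **Separation strength of the crux without the quantum half (W1 of the census).** `TorsorHard`
together with the padding lemma `PadDown` alone (no Kuperberg) puts an EXPLICIT language outside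
`BPP`: the padded vectorization-bit language `L_pad(d)` of the hard family at its own action
exponent `d`. On paper `L_pad(d) ∈ UP ∩ coUP` (guess the unique label `g`, `|g| ≤ |prm|`, and
re-apply `act` within the padding budget `m_d`), so `X ∧ PadDown ⟹ UP ∩ coUP ⊄ BPP ⟹ NP ⊄ BPP`:
every decomposition of `X` is jointly of separation strength, whatever the pieces.
[cite: AroraBarak2009, §2.6.1] -/
theorem padLang_not_mem_BPP (h₂ : PadDown) (h₃ : TorsorHard) :
    ∃ (d : ℕ) (lab elt : List Bool → List Bool → Bool) (act : List Bool → List Bool → List Bool → List Bool),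
      (∀ p z₀ z₁, elt p z₀ = true → elt p z₁ = true → ∃! g, lab p g = true ∧ act p g z₀ = z₁) ∧
      (∀ p g, lab p g = true → g.length ≤ p.length) ∧
      Literature.Computability.Complexity.PolyTimeComputable
        (fun t : List Bool × List Bool × List Bool =>
          Literature.Computability.Complexity.boolPair
            (Literature.Computability.Complexity.boolPair t.1
              (Literature.Computability.Complexity.boolPair t.2.1 t.2.2))
            (List.replicate (2 ^ (d * Nat.sqrt (t.1.length * Nat.log 2 t.1.length) + d)) true))
        (id : List Bool → List Bool) (fun t : List Bool × List Bool × List Bool => act t.1 t.2.1 t.2.2) ∧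
      ({w : List Bool | ∃ (p z₀ z₁ : List Bool) (i : ℕ),
          w = Literature.Computability.Complexity.boolPair
                (Literature.Computability.Complexity.boolPair p
                  (Literature.Computability.Complexity.boolPair z₀
                    (Literature.Computability.Complexity.boolPair z₁ (Computability.unaryEncodeNat i))))
                (List.replicate (2 ^ (d * Nat.sqrt (p.length * Nat.log 2 p.length) + d)) true) ∧
            elt p z₀ = true ∧ elt p z₁ = true ∧
            ∃ g, lab p g = true ∧ act p g z₀ = z₁ ∧
              (Literature.Computability.Complexity.boolPair g []).getD i false = true} : Language Bool) ∉
        Literature.Computability.Complexity.BPP := by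
  obtain ⟨d, lab, elt, one, mul, act, gens, hAX, hPT, hHard⟩ := h₃
  refine ⟨d, lab, elt, act, hAX.2.2.2.2.2.2.2.2.2.1, hAX.2.2.2.2.2.2.2.2.2.2.1, hPT.2.2.2.2.2,
    fun hBPP => ?_⟩
  obtain ⟨c', A, hr, hs⟩ :=
    h₂ d lab elt act hAX.2.2.2.2.2.2.2.2.2.1 hAX.2.2.2.2.2.2.2.2.2.2.1 hBPP
  exact hHard c' ⟨A, hr, hs⟩

end Summit.QuantumAdvantage.QuantumAdvantage.Cruxes.TorsorHard.Split

end
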